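import Summits.Schanuel.Schanuel.Theorems.RootDecomp1KSiegelBridge01

/-!
# RootDecomp1KSiegelBridge — part 2 (RootDecomp1KSiegelBridge02): the bridge `SiegelShapes ⟸ Lang 1983 Thm 2.4 + 5.1`

Census-1 gen 22, ×0 infrastructure on the (γ) lane (critic GO L2539; CLAUSE MAP ACK L2541).  **THE BRIDGE**
`siegelShapes_of_lang1983 : Lang1983_integralValues_planeCurve_parametric → SiegelShapes`: the K-line's residual
binder `SiegelShapes` (lens-1 g51 node 10, `RootDecomp1KLevelFinite02`; the HOME-typed consumption shape of the
Siegel–Mahler–Lang trichotomy for prime plane curves over `ℚ`, `S = {2, ∞}`) FOLLOWS from the Literature named fact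
`Literature.NumberTheory.DiophantineGeometry.Lang1983_integralValues_planeCurve_parametric` (Lang, *Fundamentals of
Diophantine Geometry* (1983) Ch. 8 Thm 2.4 p. 160 + Thm 5.1 p. 164 + p. 165, typed for the plane model in
`SiegelTheoremIntegralPoints.lean`, p841349, cite item wi-102309 DONE) through its dyadic instance
`Lang1983_integralValues_planeCurve_parametric.of_prime_int_dyadic` (`SiegelTheoremIntegralPointsRat.lean`, p842044:
`K = ℚ`, `R = ℤ[1/2]`, `f = P.map (mapRingHom (Int.castRingHom ℚ))`, Gauss's lemma for the prime `P`).  The bridge CONSUMES A WEAKER FRAGMENT of the printed theorem: only (iii) the two-pole shape of `x`,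
(iv) the finite exceptional set with the parametrisation of ALL rational points by finite parameters, and (v) the
degree clause `max (deg num x) (deg denom x) = deg_Y f`; clauses (i) `f(P, Q) = 0` and (ii) `K(P, Q) = K(t)` are not
used.  (§1) the three integral shapes from a parametrisation; (§2) the bridge — the re-pointing of node 10's headlines
to the Literature fact is part 3.  After this file the K-line's uniform results read
«`ThinFibre m₀` (all `m₀ ≥ 2`), (b), `SB 2`, the 31077 pair cell ⟸ Lang 1983 Thm 2.4 + 5.1 AS PRINTED»
(conditional-result class on a Literature fact; rung 0 — nothing here proves Schanuel, 33364 or 31077).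
-/

noncomputable section

open Polynomial

namespace Summit.Schanuel.Schanuel.Theorems.RootDecomp1KSiegelBridge

open Summit.Schanuel.Schanuel.Theorems.RootDecomp1KDegreeLadder (bev)
open Summit.Schanuel.Schanuel.Theorems.RootDecomp1KLevelFinite (IsDyadic SiegelShapes NormShapeHyp)
open Literature.NumberTheory.DiophantineGeometry (Lang1983_integralValues_planeCurve_parametric LangTwoPoleShape)

/-! ### §1  The three integral shapes from a rational parametrisation of the `x`-coordinates -/

/-- (B1) from a POLYNOMIAL parametrisation `x = p₁(t)`, `deg p₁ ≥ 2` (integer scaling `p₁ = f/D`). -/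
theorem polyShape_of_param (P : ℤ[X][X]) (Ex : Finset ℚ) {p₁ : ℚ[X]} (h2 : 2 ≤ p₁.natDegree)
    (hrel : ∀ x r : ℚ, bev P x r = 0 → x ∈ Ex ∨ ∃ t : ℚ, p₁.eval t = x) :
    ∃ (f : ℤ[X]) (D : ℤ) (E : Finset ℚ), 2 ≤ f.natDegree ∧ D ≠ 0 ∧
      ∀ x r : ℚ, bev P x r = 0 → x ∈ E ∨ ∃ t : ℚ, aeval t f = D * x := by
  obtain ⟨F, b, hb, hF⟩ := exists_int_scaling p₁
  refine ⟨F, b, Ex, by rwa [natDegree_of_int_scaling hb hF], hb, fun x r hxr => ?_⟩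
  rcases hrel x r hxr with h | ⟨t, ht⟩
  · exact Or.inl h
  · exact Or.inr ⟨t, by rw [aeval_of_int_scaling hF, coe_aeval_eq_eval, ht]⟩

/-- (B2a) from a LAURENT parametrisation `g₀(t) = x·tᵃ`, `t ≠ 0`, `g₀(0) ≠ 0`, `1 ≤ a < deg g₀`. -/
theorem laurentShape_of_param (P : ℤ[X][X]) (Ex : Finset ℚ) {g₀ : ℚ[X]} {a : ℕ} (ha : 1 ≤ a)
    (hlt : a < g₀.natDegree) (hg0 : g₀.coeff 0 ≠ 0)
    (hrel : ∀ x r : ℚ, bev P x r = 0 → x ∈ Ex ∨ ∃ t : ℚ, t ≠ 0 ∧ g₀.eval t = x * t ^ a) :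
    ∃ (g : ℤ[X]) (a : ℕ) (D : ℤ) (E : Finset ℚ), 1 ≤ a ∧ a < g.natDegree ∧ g.coeff 0 ≠ 0 ∧ D ≠ 0 ∧
      ∀ x r : ℚ, bev P x r = 0 → x ∈ E ∨ ∃ t : ℚ, t ≠ 0 ∧ aeval t g = D * x * t ^ a := by
  obtain ⟨G, b, hb, hG⟩ := exists_int_scaling g₀
  refine ⟨G, a, b, Ex, ha, by rwa [natDegree_of_int_scaling hb hG], ?_, hb, fun x r hxr => ?_⟩
  · have hc := congrArg (fun p : ℚ[X] => p.coeff 0) hG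
    simp only [coeff_map, eq_intCast, coeff_C_mul] at hc
    intro h0
    rw [h0, Int.cast_zero] at hc
    exact mul_ne_zero (by exact_mod_cast hb : (b : ℚ) ≠ 0) hg0 hc.symm
  · rcases hrel x r hxr with h | ⟨t, ht0, ht⟩
    · exact Or.inl h
    · exact Or.inr ⟨t, ht0, by rw [aeval_of_int_scaling hG, coe_aeval_eq_eval, ht, mul_assoc]⟩

/-- integer scaling seen in any `ℚ`-algebra (used over `ℂ` for the root conditions of `NormShapeHyp`). -/
private theorem aeval_of_int_scaling' {A : Type*} [CommRing A] [Algebra ℚ A] {g : ℚ[X]} {G : ℤ[X]} {b : ℤ}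
    (hG : G.map (Int.castRingHom ℚ) = C (b : ℚ) * g) (z : A) : aeval z G = (b : A) * aeval z g := by
  have h1 : aeval z (G.map (algebraMap ℤ ℚ)) = aeval z G := aeval_map_algebraMap ℚ z G
  rw [algebraMap_int_eq, hG, map_mul, aeval_C] at h1
  rw [← h1, map_intCast]

/-- (B2b) from a NORM parametrisation `g₀(t) = x·q(t)ᵃ` with `q` an irreducible quadratic not dividing `g₀`,
`1 ≤ a`, `deg g₀ ≤ 2a` (integer scaling of `q` and `g₀`; the scaling factor of `q` is absorbed into `g`). -/
theorem normShape_of_param (P : ℤ[X][X]) (Ex : Finset ℚ) {g₀ q : ℚ[X]} {a : ℕ} (hq : Irreducible q)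
    (hq2 : q.natDegree = 2) (hnd : ¬ q ∣ g₀) (ha : 1 ≤ a) (hdeg : g₀.natDegree ≤ 2 * a)
    (hrel : ∀ x r : ℚ, bev P x r = 0 → x ∈ Ex ∨ ∃ t : ℚ, g₀.eval t = x * (q.eval t) ^ a) :
    ∃ (g q : ℤ[X]) (a : ℕ) (D : ℤ) (E : Finset ℚ), NormShapeHyp g q a D ∧
      ∀ x r : ℚ, bev P x r = 0 → x ∈ E ∨ ∃ t : ℚ, aeval t g = D * x * (aeval t q) ^ a := by
  obtain ⟨Qz, bq, hbq, hQ⟩ := exists_int_scaling q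
  obtain ⟨G, bg, hbg, hG⟩ := exists_int_scaling g₀
  have hbq' : (bq : ℚ) ≠ 0 := by exact_mod_cast hbq
  refine ⟨C (bq ^ a) * G, Qz, a, bg, Ex, ⟨?_, ?_, ?_, ha, ?_, hbg⟩, fun x r hxr => ?_⟩
  · rw [natDegree_of_int_scaling hbq hQ, hq2]
  · intro t
    rw [aeval_of_int_scaling hQ, coe_aeval_eq_eval]
    exact mul_ne_zero hbq' (eval_ne_zero_of_irreducible_quadratic hq hq2 t)
  · intro z hz
    rw [aeval_of_int_scaling' hQ] at hz
    have hzq : aeval z q = 0 := by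
      rcases mul_eq_zero.mp hz with h | h
      · exact absurd h (by exact_mod_cast hbq)
      · exact h
    rw [map_mul, aeval_C, aeval_of_int_scaling' hG]
    refine mul_ne_zero ?_ (mul_ne_zero (by exact_mod_cast hbg) (aeval_ne_zero_of_irreducible_not_dvd hq hnd hzq))
    rw [algebraMap_int_eq, eq_intCast]
    exact_mod_cast pow_ne_zero a hbq
  · rw [natDegree_C_mul (pow_ne_zero a hbq), natDegree_of_int_scaling hbg hG]; exact hdeg
  · rcases hrel x r hxr with h | ⟨t, ht⟩
    · exact Or.inl h
    · refine Or.inr ⟨t, ?_⟩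
      rw [map_mul, aeval_C, aeval_of_int_scaling hG, aeval_of_int_scaling hQ, coe_aeval_eq_eval, ht,
        algebraMap_int_eq, eq_intCast]
      push_cast
      ring

/-! ### §2  The bridge -/

/-- **THE BRIDGE `SiegelShapes ⟸ LANG 1983 Thm 2.4 + 5.1 (as printed and typed in the tree).**  For a prime
`P ∈ ℤ[x][Y]` of `Y`-degree `≥ 2`: if infinitely many dyadic `x` carry a rational point of `P = 0`, then the dyadic
instance of the Literature fact (`…of_prime_int_dyadic`: the `ℚ`-model is irreducible by Gauss's lemma and has
infinitely many `ℤ[1/2]`-integral-value points) gives a rational parametrisation `x = P(t)` of all but finitely many rational points with `P` of one of LANG's two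
pole shapes and `max (deg num P) (deg denom P) = deg_Y P ≥ 2`; cancelling common powers, flipping `t ↦ 1/t` where
needed and scaling to integer coefficients yields one of the three integral shapes of `SiegelShapes`. -/
theorem siegelShapes_of_lang1983 (hL : Lang1983_integralValues_planeCurve_parametric) : SiegelShapes := by
  classical
  intro P hP hdeg
  by_cases hA : Set.Finite {x : ℚ | IsDyadic x ∧ ∃ r : ℚ, bev P x r = 0}
  · exact Or.inl hA
  right
  obtain ⟨Pt, Qt, -, -, hshape, ⟨E, hE⟩, hdc⟩ :=
    Lang1983_integralValues_planeCurve_parametric.of_prime_int_dyadic hL hP (by omega) (dyadic_points_infinite P hA)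
  -- the degree clause: `max (deg num) (deg denom) = deg_Y P ≥ 2`
  have h2 : 2 ≤ max Pt.num.natDegree Pt.denom.natDegree := by rw [hdc]; exact hdeg
  -- every rational point outside `E` is parametrised by a finite `t` with the reduced denominator non-zero
  set Ex : Finset ℚ := E.image Prod.fst with hEx
  have hpar : ∀ x r : ℚ, bev P x r = 0 → x ∈ Ex ∨
      ∃ t : ℚ, Pt.denom.eval t ≠ 0 ∧ Pt.eval (RingHom.id ℚ) t = x := by
    intro x r hxr
    rcases hE x r ((bev_eq_zero_iff P x r).mp hxr) with hmem | ⟨t, ht1, -, ht2, -⟩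
    · exact Or.inl (Finset.mem_image.mpr ⟨(x, r), hmem, rfl⟩)
    · exact Or.inr ⟨t, ht1, ht2⟩
  -- a non-zero numerator: `Pt = 0` contradicts the degree clause
  have hPt0 : ∀ {g : ℚ[X]} {d : RatFunc ℚ}, Pt = algebraMap ℚ[X] (RatFunc ℚ) g / d → g ≠ 0 := by
    intro g d hPt hg
    rw [hg, map_zero, zero_div, ← (algebraMap ℚ[X] (RatFunc ℚ)).map_zero] at hPt
    rw [hPt, degClause_algebraMap, natDegree_zero] at h2
    omega
  rcases hshape with ⟨g, m, hPt⟩ | ⟨g, q, m, hq, hq2, hm, hgm, hPt⟩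
  · ------------------------------------------------------------------ first shape `x = g(t)/tᵐ`
    rw [← RatFunc.algebraMap_X] at hPt
    have hg : g ≠ 0 := hPt0 hPt
    obtain ⟨k, g₀, hgk, hg0⟩ := exists_X_pow_mul_coeff_zero_ne hg
    have hg0' : g₀ ≠ 0 := fun h => hg0 (by rw [h, coeff_zero])
    rw [hgk] at hPt
    rcases Nat.lt_or_ge k m with hkm | hmk
    swap
    · -- `k ≥ m`: POLYNOMIAL `x = t^(k−m)·g₀(t)`
      rw [repr_cancel_ge X_ne_zero hmk] at hPt
      refine Or.inl (polyShape_of_param P Ex (p₁ := X ^ (k - m) * g₀) ?_ fun x r hxr => ?_)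
      · rw [hPt, degClause_algebraMap] at h2; exact h2
      · rcases hpar x r hxr with h | ⟨t, hden, hx⟩
        · exact Or.inl h
        · refine Or.inr ⟨t, ?_⟩
          have := eval_eq_mul_of_repr one_ne_zero (hPt.trans (repr_algebraMap _)) hden hx
          rwa [eval_one, mul_one] at this
    · -- `k < m`: `x = g₀(t)/tᵃ`, `a = m − k ≥ 1`, `g₀(0) ≠ 0`
      rw [repr_cancel_le X_ne_zero hkm.le] at hPt
      have hrel : ∀ x r : ℚ, bev P x r = 0 → x ∈ Ex ∨ ∃ t : ℚ, t ≠ 0 ∧ g₀.eval t = x * t ^ (m - k) := by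
        intro x r hxr
        rcases hpar x r hxr with h | ⟨t, hden, hx⟩
        · exact Or.inl h
        · have ht := eval_eq_mul_of_repr (pow_ne_zero _ X_ne_zero) hPt hden hx
          rw [eval_pow, eval_X] at ht
          refine Or.inr ⟨t, fun h0 => hg0 ?_, ht⟩
          rw [coeff_zero_eq_eval_zero, ← h0, ht, h0, zero_pow (by omega), mul_zero]
      rcases Nat.lt_or_ge (m - k) g₀.natDegree with hlt | hle
      · -- LAURENT shape
        exact Or.inr (Or.inl (laurentShape_of_param P Ex (by omega) hlt hg0 hrel))
      · -- FLIP `s = 1/t`: POLYNOMIAL shape `x = (reflect a g₀)(s)` of degree `a ≥ 2`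
        have ha2 : 2 ≤ m - k := by
          have := degClause_le_of_repr hg0' (pow_ne_zero (m - k) X_ne_zero) hPt
          rw [natDegree_X_pow, max_eq_right hle] at this
          omega
        refine Or.inl (polyShape_of_param P Ex (p₁ := reflect (m - k) g₀)
          (ha2.trans (le_natDegree_reflect hg0)) fun x r hxr => ?_)
        rcases hrel x r hxr with h | ⟨t, ht0, ht⟩
        · exact Or.inl h
        · exact Or.inr ⟨t⁻¹, eval_reflect_inv_of_eval_eq hle ht0 ht⟩
  · ------------------------------------------------------------------ second shape `x = g(t)/q(t)ᵐ`
    have hq0 : q ≠ 0 := hq.ne_zero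
    have hg : g ≠ 0 := hPt0 hPt
    obtain ⟨k, g₀, hgk, hnd⟩ := exists_pow_mul_not_dvd hg hq
    have hg0' : g₀ ≠ 0 := fun h => hnd (by rw [h]; exact dvd_zero q)
    have hdegg : g.natDegree = 2 * k + g₀.natDegree := by
      rw [hgk, natDegree_mul (pow_ne_zero _ hq0) hg0', natDegree_pow, hq2]; ring
    rw [hgk] at hPt
    rcases Nat.lt_or_ge k m with hkm | hmk
    swap
    · -- `k ≥ m`: `x` would be a polynomial of degree `deg g − 2m ≤ 0` — contradicts the degree clause
      exfalso
      rw [repr_cancel_ge hq0 hmk] at hPt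
      rw [hPt, degClause_algebraMap, natDegree_mul (pow_ne_zero _ hq0) hg0', natDegree_pow, hq2] at h2
      omega
    · -- `k < m`: NORM shape `x = g₀(t)/q(t)ᵃ`, `a = m − k ≥ 1`, `q ∤ g₀`, `deg g₀ ≤ 2a`
      rw [repr_cancel_le hq0 hkm.le] at hPt
      refine Or.inr (Or.inr (normShape_of_param P Ex (a := m - k) hq hq2 hnd (by omega) (by omega)
        fun x r hxr => ?_))
      rcases hpar x r hxr with h | ⟨t, hden, hx⟩
      · exact Or.inl h
      · have ht := eval_eq_mul_of_repr (pow_ne_zero _ hq0) hPt hden hx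
        rw [eval_pow] at ht
        exact Or.inr ⟨t, ht⟩

end Summit.Schanuel.Schanuel.Theorems.RootDecomp1KSiegelBridge

end
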